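import Summits.QuantumFields.YangMills.Theorems.BalabanLadderIRDefectSquaringSharp
import Summits.QuantumFields.YangMills.Theorems.BalabanLadderIRColdPurityBridge
import HarnessLib

/-!
# The abstract purity bootstrap contracts from `2⁻⁹`: the seed of the `IR` bill at ONE tolerance `2⁻⁹` at ONE scale

HONEST FRAMING.  Nothing here proves the Yang–Mills mass gap (Clay), a lattice gap, the crux `BalabanLadder.IR` (stmt-QuantumFields-19354) or its
seed; `R4` closes only the conditional finite-𝕋⁴ rung `BalabanLadder.UV`.  This file is sorry-free POSITIVE GLUE over tree names (helper for item
19354, line `basin-transfer` of ideator ym-ir-idea-9; critic ym-ir-crit-3 «PASS on the kernel content — land it», VERDICT-basin-transfer 2026-08-28;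
RULING director-ym g9-№2): model-free reflection-positivity bookkeeping valid for every compact gauge group at every `β ≥ 0`, plus its composition
with the landed seam of record.  All Yang–Mills content stays in the hypotheses `ColdExitAt (1/2^9)`, `AFToColdPressure`, `IRnsc`.

CONTENT.
* `ColdExitAt θ` — the seed E at ONE tolerance: eventually in `β`, ONE cold `4:1` torus of side `L ≥ 8` has purity defect `coldDefect ≤ θ`
  (weaker than the tree's `ColdExitSC` = all tolerances from all base scales: `coldExitAt_of_coldExitSC`).
* `coldPressureOnsetSC_of_exitAt : ColdExitAt epsStar → ColdPressureOnsetSC`, `epsStar = 1/(16·max 2²⁰ 2) = 2⁻²⁴` — the landed sharp recursion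
  `coldDefect_sq_le_two_pow` fed to the landed seam `coldPressureAt_of_exit_recursion` at the exit scale itself; `IR_of_exitAt` via `IR_of_cp_repaired`.
* `AbstractBasin θ ε` — group-free basin enlargement in the abstract class `IsAxisSymmetric ∧ IsTracePositive ∧ HasVolumeBounds` of the landed
  bootstrap, and the PROVED RUNG `abstractBasin_two_pow_9 : AbstractBasin (1/2^9) epsStar`: the δ-dependent squaring contracts far above the
  bookkeeping threshold `2⁻²⁴` once two elementary sharpenings are made — EXACT DOUBLING `L' = 2L` in the three extensions (`extension_le` at
  `L'/L = 2`: `(3/2·2)³ = 27` instead of `216`) and the SHARP EXCESS BOUND `exc_le_sharp` (`δ ≤ η ≤ 1/2 ⇒ exc ≤ η(1+2η)²/2`, asymptotically `exc ≈ δ/2`,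
  from `exc(2t) ≤ exc(t)²`; the landed `defect_facts` clause gives `2η`).  Net: `δ(2L) ≤ 2(13.61·δ·e^{13.61 δ})²` for `δ = δ(L) ≤ 2⁻⁹` (linear constant
  `13.61` vs the landed `432`), i.e. `δ(2L) ≤ 395·u²` for `δ(L) ≤ u ≤ 2⁻⁹`, contracting below `δ* ≈ 2^{−8.6}`; six doublings reach `2⁻²⁴`.
* `IR_of_exitAt9 : ColdExitAt (1/2^9) → AFToColdPressure → IRnsc → BalabanLadder.IR` — the bill of record (`ColdPurityBridge.IR_of_bridge`:
  E = `ColdExitSC`, ∀ε ∀L₀) re-based on a seed at ONE tolerance `2⁻⁹ ≈ 0.2 %` at ONE scale (SU(2), β_W = 2.4: a glueball-gas synthesis puts the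
  witness box at `L ≈ 52a ≈ 6 fm`, against `≈ 100a` for `2⁻²⁴`).
CEILING (honest): with the volume law `Y(2L-box) ≈ 8·Y(L-box)` and `exc ≈ δ/2` the abstract map is `δ ↦ 32δ²` (fixed point `1/32`); raising the
abstract basin further (line `basin-transfer`, stub `AbstractBasin (1/2^6) (1/2^9)`) needs the extension inequality at the volume law, not `27`.

Sources: tree `AspectBootstrap.extension_le`, `defect_facts`, `exc_two_mul_le_sq`, `exc_eq_exp_Yfun`, `coldDefect_sq_le_two_pow`,
`ColdPurityBridge.coldPressureAt_of_exit_recursion`, `ColdPressurePincer.IR_of_cp_repaired`; Knabe1988, GossetMozgunov2016, LemmSandvikWang2020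
(arXiv:1910.11810) for the threshold-raising pattern (finite-size gap criteria) this transplants to the purity bootstrap.
-/

set_option autoImplicit false

noncomputable section

open MeasureTheory Filter Topology
open Literature.MathematicalPhysics.QuantumFieldTheory Literature.MathematicalPhysics.QuantumLattice
open Summit.QuantumFields.YangMills.Cruxes.IR.ColdPressurePincer
open Summit.QuantumFields.YangMills.Cruxes.IR.ColdPurityBridge
open Summit.QuantumFields.YangMills.Cruxes.IR.AspectBootstrap

namespace Summit.QuantumFields.YangMills.Cruxes.IR.BasinRung

/-! ## §1 Statements -/

/-- The basin threshold of record `ε⋆ = 1/(16 · max 2²⁰ 2)` (`= 2⁻²⁴`, `epsStar_eq`): below it the PROVED explicit recursion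
`coldDefect_sq_le_two_pow` contracts (`ColdPurityBridge.coldPressureAt_of_exit_recursion`). -/
def epsStar : ℝ := 1 / (16 * max (2 ^ 20 : ℝ) 2)

/-- `epsStar = 2⁻²⁴`. -/
theorem epsStar_eq : epsStar = 1 / 2 ^ 24 := by
  unfold epsStar; rw [max_eq_left (by norm_num)]; norm_num


/-- **`E(θ)` = `ColdExitAt θ` — the seed at ONE tolerance.**  For every simply-connected compact simple `G`, every lattice
representation `r`, eventually in `β`: ONE cold `4:1` torus of side `L ≥ 8` has purity defect `δᶜ_β(L) ≤ θ`
(`coldDefect r.ρ β L = 1 − Z_β(L³×2⌊L/4⌋)/Z_β(L³×⌊L/4⌋)²`, tree `ColdPurityBridge.coldDefect`).  Weaker than `ColdExitSC` (all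
tolerances, all base scales): `coldExitAt_of_coldExitSC`; monotone in `θ`: `coldExitAt_mono`. -/
def ColdExitAt (θ : ℝ) : Prop :=
  ∀ (G : Type) [Group G] [TopologicalSpace G] [IsTopologicalGroup G] [CompactSpace G],
    IsCompactSimpleLieGroup G → SimplyConnectedSpace G →
    letI : MeasurableSpace G := borel G; haveI : BorelSpace G := ⟨rfl⟩;
    ∀ r : LatticeRep G, ∃ β₁ : ℝ, ∀ β : ℝ, β₁ ≤ β → ∃ L : ℕ, 8 ≤ L ∧ coldDefect r.ρ β L ≤ θ

/-- **`AbstractBasin θ ε` — basin enlargement, group-free STRENGTHENING (`C⁺`).**  For every axis-symmetric, trace-positive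
(integer-multiplicity spectral data, `HasSpectralDatum`) family with volume bounds — the abstract class of the PROVED bootstrap
`defectSquaring` —: `θ`-purity at one scale `≥ 8` forces `ε`-purity at some scale `≥ 8`.  Transports the model seed
(`coldExitAt_of_abstractBasin`): Wilson's theory at `β ≥ 0` is such a family (`axisSymmetric`, `tracePositive`, `volumeBounds`,
`coldDefect_eq_boxDefect`). -/
def AbstractBasin (θ ε : ℝ) : Prop :=
  ∀ Z : ℕ → ℕ → ℕ → ℕ → ℝ, IsAxisSymmetric Z → IsTracePositive Z → HasVolumeBounds Z →
    ∀ L : ℕ, 8 ≤ L → boxDefect Z L ≤ θ → ∃ L' : ℕ, 8 ≤ L' ∧ boxDefect Z L' ≤ ε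

/-! ## §2 Seams (model side) -/

/-- `E` at all tolerances (`ColdExitSC`, line `doubling-bridge`) gives `E(θ)` for every `θ > 0`: the seed here is WEAKER. -/
theorem coldExitAt_of_coldExitSC {θ : ℝ} (hθ : 0 < θ) (hE : ColdExitSC) : ColdExitAt θ := by
  intro G _ _ _ _ hG hsc
  letI : MeasurableSpace G := borel G
  haveI : BorelSpace G := ⟨rfl⟩
  intro r
  obtain ⟨β₁, hβ₁⟩ := hE G hG hsc r θ hθ
  exact ⟨β₁, fun β hβ => hβ₁ β hβ 8⟩

/-- `E(θ)` is monotone in the tolerance. -/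
theorem coldExitAt_mono {θ θ' : ℝ} (h : θ ≤ θ') (hE : ColdExitAt θ) : ColdExitAt θ' := by
  intro G _ _ _ _ hG hsc
  letI : MeasurableSpace G := borel G
  haveI : BorelSpace G := ⟨rfl⟩
  intro r
  obtain ⟨β₁, hβ₁⟩ := hE G hG hsc r
  refine ⟨β₁, fun β hβ => ?_⟩
  obtain ⟨L, hL, hδ⟩ := hβ₁ β hβ
  exact ⟨L, hL, hδ.trans h⟩

/-- **The abstract basin transports the model seed**: `E(θ) → AbstractBasin(θ → ε) → E(ε)` (Wilson's theory at `β ≥ 0` is an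
axis-symmetric trace-positive family with volume bounds). -/
theorem coldExitAt_of_abstractBasin {θ ε : ℝ} (hS : ColdExitAt θ) (hA : AbstractBasin θ ε) : ColdExitAt ε := by
  intro G _ _ _ _ hG hsc
  letI : MeasurableSpace G := borel G
  haveI : BorelSpace G := ⟨rfl⟩
  intro r
  obtain ⟨β₁, hβ₁⟩ := hS G hG hsc r
  refine ⟨max β₁ 0, fun β hβ => ?_⟩
  have hββ₁ : β₁ ≤ β := le_trans (le_max_left _ _) hβ
  have hβ0 : 0 ≤ β := le_trans (le_max_right _ _) hβ
  obtain ⟨L, hL, hδ⟩ := hβ₁ β hββ₁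
  rw [coldDefect_eq_boxDefect] at hδ
  obtain ⟨L', hL', hδ'⟩ := hA _ (axisSymmetric r β) (tracePositive r hβ0) (volumeBounds r hβ0) L hL hδ
  exact ⟨L', hL', by rw [coldDefect_eq_boxDefect]; exact hδ'⟩

/-- **The single-tolerance seed suffices**: `ColdExitAt ε⋆ → ColdPressureOnsetSC`, by the PROVED explicit recursion
`coldDefect_sq_le_two_pow` (`C = 2²⁰`, every `β ≥ 0`, `L ≥ 8`) fed to the PROVED seam `coldPressureAt_of_exit_recursion` at the exit
scale itself (`ξ = L ≥ 8 ≥ 1`). -/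
theorem coldPressureOnsetSC_of_exitAt (hE : ColdExitAt epsStar) : ColdPressureOnsetSC := by
  intro G _ _ _ _ hG hsc
  letI : MeasurableSpace G := borel G
  haveI : BorelSpace G := ⟨rfl⟩
  intro r
  obtain ⟨β₁, hβ₁⟩ := hE G hG hsc r
  refine ⟨max β₁ 0, fun β hβ => ?_⟩
  have hββ₁ : β₁ ≤ β := le_trans (le_max_left _ _) hβ
  have hβ0 : 0 ≤ β := le_trans (le_max_right _ _) hβ
  obtain ⟨L, hL8, hδ⟩ := hβ₁ β hββ₁
  have hrec : ∀ L : ℕ, 8 ≤ L → ∀ L' : ℕ, 2 * L ≤ L' → L' ≤ 4 * L →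
      coldDefect r.ρ β L' ≤ 2 ^ 20 * coldDefect r.ρ β L ^ 2 :=
    fun L hL L' h₁ h₂ => coldDefect_sq_le_two_pow r hβ0 L hL L' h₁ h₂
  have hLs : max 8 8 ≤ L := by rw [max_self]; exact hL8
  have hex : coldDefect r.ρ β L ≤ 1 / (16 * max (2 ^ 20 : ℝ) 2) := hδ
  exact ⟨L, by omega, coldPressureAt_of_exit_recursion r hβ0 (by norm_num) hrec hLs hex⟩

/-- **`IR` from the single-tolerance seed**, the AF pin X and the residual N (tree `ColdPressurePincer.IR_of_cp_repaired`). -/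
theorem IR_of_exitAt (hE : ColdExitAt epsStar) (hX : AFToColdPressure) (hN : IRnsc) :
    Summit.QuantumFields.YangMills.Theses.BalabanLadder.IR :=
  IR_of_cp_repaired (coldPressureOnsetSC_of_exitAt hE) hX hN


/-! ## §3 The PROVED RUNG: the abstract basin contracts from `2⁻⁹` -/

/-- **Sharp one-box excess bound**: if the `2:1` defect `1 − z(2t)/z(t)² ≤ η ≤ 1/2` then `exc z t ≤ η (1+2η)²/2` (asymptotically `exc ≈ δ/2`;
the landed `defect_facts` clause gives only `exc ≤ 2η`).  Uses `exc z (2t) ≤ (exc z t)²`. -/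
theorem exc_le_sharp {z : ℕ → ℝ} (h : HasSpectralDatum z) (m : ℕ) {η : ℝ} (hη : η ≤ 1 / 2)
    (hδ : 1 - z (2 * (m + 2)) / z (m + 2) ^ 2 ≤ η) : exc z (m + 2) ≤ η * (1 + 2 * η) ^ 2 / 2 := by
  have hx2η : exc z (m + 2) ≤ 2 * η := (defect_facts h m).2.2.2 η hη hδ
  have hx1 := exc_nonneg h m
  have e1 := z_eq_exp_mul z m
  have e2 : z (2 * (m + 2)) = Real.exp (((2 * (m + 2) : ℕ) : ℝ) * phi z) * (1 + exc z (2 * (m + 2))) := by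
    have := z_eq_exp_mul z (2 * m + 2)
    rwa [show 2 * m + 2 + 2 = 2 * (m + 2) from by ring] at this
  have e3 : Real.exp (((2 * (m + 2) : ℕ) : ℝ) * phi z) = Real.exp (((m + 2 : ℕ) : ℝ) * phi z) ^ 2 := by
    rw [← Real.exp_nat_mul]; push_cast; ring_nf
  have hE : 0 < Real.exp (((m + 2 : ℕ) : ℝ) * phi z) := Real.exp_pos _
  have hx2sq : exc z (2 * (m + 2)) ≤ exc z (m + 2) ^ 2 := exc_two_mul_le_sq h m
  set x : ℝ := exc z (m + 2) with hxdef
  set x2 : ℝ := exc z (2 * (m + 2)) with hx2def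
  have hx0 : (1 + x) ≠ 0 := ne_of_gt (by linarith)
  have hratio : z (2 * (m + 2)) / z (m + 2) ^ 2 = (1 + x2) / (1 + x) ^ 2 := by
    rw [e2, e3, e1]
    field_simp
  rw [hratio] at hδ
  -- `1 − (1+x2)/(1+x)² ≤ η` ⇒ `(1+x)² − (1+x2) ≤ η (1+x)²` ⇒ `2x ≤ η(1+x)²` (using `x2 ≤ x²`)
  have hpos : 0 < (1 + x) ^ 2 := by positivity
  have h1 : (1 + x) ^ 2 - (1 + x2) ≤ η * (1 + x) ^ 2 := by
    have := hδ
    rw [sub_le_iff_le_add, ← sub_le_iff_le_add', le_div_iff₀ hpos] at this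
    linarith
  have h2 : 2 * x ≤ η * (1 + x) ^ 2 := by nlinarith
  have hη0 : 0 ≤ η := by nlinarith
  have h3 : (1 + x) ^ 2 ≤ (1 + 2 * η) ^ 2 := by
    have : 0 ≤ 1 + x := by linarith
    exact pow_le_pow_left₀ this (by linarith) 2
  have h4 : η * (1 + x) ^ 2 ≤ η * (1 + 2 * η) ^ 2 := mul_le_mul_of_nonneg_left h3 hη0
  linarith

section Rung
variable {Z : ℕ → ℕ → ℕ → ℕ → ℝ}

/-- **Sharp δ-dependent squaring at exact doubling, small-defect regime**: for `L ≥ 8` and `δ = boxDefect Z L ≤ 2⁻⁹`: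
`boxDefect Z (2L) ≤ 2 (13.61 δ e^{13.61 δ})²` (constant `27 · (1+2δ)²/2 ≤ 13.61`; compare the landed `432`). -/
theorem defectSquaring_double_sharp (hS : IsAxisSymmetric Z) (hT : IsTracePositive Z) (hV : HasVolumeBounds Z)
    (L : ℕ) (hL : 8 ≤ L) (hsmall : boxDefect Z L ≤ 1 / 2 ^ 9) :
    boxDefect Z (2 * L) ≤ 2 * (13.61 * boxDefect Z L * Real.exp (13.61 * boxDefect Z L)) ^ 2 := by
  set L' := 2 * L with hL'def
  obtain ⟨k, hk⟩ : ∃ k, L / 4 = k + 2 := ⟨L / 4 - 2, by omega⟩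
  obtain ⟨k', hk'⟩ : ∃ k', L' / 4 = k' + 2 := ⟨L' / 4 - 2, by omega⟩
  have hkk' : 2 * k + 2 ≤ k' := by omega
  have hLpos : 0 < L := by omega
  have hLL' : L ≤ L' := by omega
  have hL2 : 2 ≤ L := by omega
  have hL'2 : 2 ≤ L' := by omega
  have hz : HasSpectralDatum (Z L L L) := hT L L L hL2 hL2 hL2
  have hz' : HasSpectralDatum (Z L' L' L') := hT L' L' L' hL'2 hL'2 hL'2
  simp only [boxDefect, hk] at hsmall
  simp only [boxDefect, hk, hk']
  obtain ⟨hδ0, -, -, -⟩ := defect_facts hz k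
  obtain ⟨-, hδ'1, hδ'x, -⟩ := defect_facts hz' k'
  set δ : ℝ := 1 - Z L L L (2 * (k + 2)) / Z L L L (k + 2) ^ 2 with hδdef
  set δ' : ℝ := 1 - Z L' L' L' (2 * (k' + 2)) / Z L' L' L' (k' + 2) ^ 2 with hδ'def
  have hhalf : δ ≤ 1 / 2 := hsmall.trans (by norm_num)
  have hx : exc (Z L L L) (k + 2) ≤ δ * (1 + 2 * δ) ^ 2 / 2 := exc_le_sharp hz k hhalf le_rfl
  have hc : δ * (1 + 2 * δ) ^ 2 / 2 ≤ 13.61 / 27 * δ := by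
    have h1 : (1 + 2 * δ) ^ 2 ≤ (1 + 2 * (1 / 2 ^ 9 : ℝ)) ^ 2 :=
      pow_le_pow_left₀ (by linarith) (by linarith) 2
    have h2 : (1 + 2 * (1 / 2 ^ 9 : ℝ)) ^ 2 ≤ 2 * (13.61 / 27) := by norm_num
    nlinarith
  have hy : Yfun (Z L L L) (k + 2) ≤ 13.61 / 27 * δ := ((Yfun_le_exc hz k).trans hx).trans hc
  have hy0 : 0 ≤ Yfun (Z L L L) (k + 2) := Yfun_nonneg hz k
  have hLr : (0 : ℝ) < L := by exact_mod_cast hLpos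
  have hq : (L' : ℝ) / L = 2 := by
    rw [div_eq_iff hLr.ne', hL'def]; push_cast; ring
  have e1 := extension_le hS hT hV hL2 hL2 hL hLL'
  have e2 := extension_le hS hT hV hL'2 hL2 hL hLL'
  have e3 := extension_le hS hT hV hL'2 hL'2 hL hLL'
  rw [hk] at e1 e2 e3
  have s1 : Z L' L L = Z L L' L := funext fun τ => (hS L' L L τ).2.1
  have s2 : Z L' L' L = Z L L' L' := funext fun τ => (hS L' L' L τ).2.2
  rw [s1] at e1
  rw [s2] at e2
  rw [hq] at e1 e2 e3
  have hY' : Yfun (Z L' L' L') (k + 2) ≤ 27 * Yfun (Z L L L) (k + 2) := by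
    calc Yfun (Z L' L' L') (k + 2) ≤ 3 / 2 * 2 * Yfun (Z L L' L') (k + 2) := e3
      _ ≤ 3 / 2 * 2 * (3 / 2 * 2 * Yfun (Z L L' L) (k + 2)) := mul_le_mul_of_nonneg_left e2 (by positivity)
      _ ≤ 3 / 2 * 2 * (3 / 2 * 2 * (3 / 2 * 2 * Yfun (Z L L L) (k + 2))) :=
          mul_le_mul_of_nonneg_left (mul_le_mul_of_nonneg_left e1 (by positivity)) (by positivity)
      _ = 27 * Yfun (Z L L L) (k + 2) := by ring
  have hx't : exc (Z L' L' L') (k + 2) ≤ Real.exp (13.61 * δ) - 1 := by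
    rw [exc_eq_exp_Yfun hz' k]
    have : Yfun (Z L' L' L') (k + 2) ≤ 13.61 * δ := by linarith
    linarith [Real.exp_le_exp.2 this]
  have hx't0 : 0 ≤ exc (Z L' L' L') (k + 2) := exc_nonneg hz' k
  have hx'T : exc (Z L' L' L') (k' + 2) ≤ exc (Z L' L' L') (k + 2) ^ 2 :=
    calc exc (Z L' L' L') (k' + 2) ≤ exc (Z L' L' L') (2 * k + 2 + 2) := exc_antitone hz' hkk'
      _ = exc (Z L' L' L') (2 * (k + 2)) := by ring_nf
      _ ≤ exc (Z L' L' L') (k + 2) ^ 2 := exc_two_mul_le_sq hz' k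
  have hu : Real.exp (13.61 * δ) - 1 ≤ 13.61 * δ * Real.exp (13.61 * δ) :=
    Literature.Analysis.ODE.exp_sub_one_le_mul_exp _
  have hE1 : 1 ≤ Real.exp (13.61 * δ) := Real.one_le_exp (by positivity)
  have hu0 : 0 ≤ Real.exp (13.61 * δ) - 1 := by linarith
  calc δ' ≤ 2 * exc (Z L' L' L') (k' + 2) := hδ'x
    _ ≤ 2 * exc (Z L' L' L') (k + 2) ^ 2 := by linarith [hx'T]
    _ ≤ 2 * (Real.exp (13.61 * δ) - 1) ^ 2 := by gcongr
    _ ≤ 2 * (13.61 * δ * Real.exp (13.61 * δ)) ^ 2 := by gcongr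

/-- Nonnegativity of the box defect at scales `L ≥ 8` (from `defect_facts`). -/
theorem boxDefect_nonneg_of_le (hT : IsTracePositive Z) (L : ℕ) (hL : 8 ≤ L) : 0 ≤ boxDefect Z L := by
  have hL2 : 2 ≤ L := by omega
  obtain ⟨k, hk⟩ : ∃ k, L / 4 = k + 2 := ⟨L / 4 - 2, by omega⟩
  have h := (defect_facts (hT L L L hL2 hL2 hL2) k).1
  simpa only [boxDefect, hk] using h

/-- numerical heart: `0 ≤ δ ≤ u ≤ 2⁻⁹ ⇒ 2 (13.61 δ e^{13.61 δ})² ≤ 395 u²`. -/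
theorem sq_step9 {δ u : ℝ} (h0 : 0 ≤ δ) (hu : δ ≤ u) (hu9 : u ≤ 1 / 2 ^ 9) :
    2 * (13.61 * δ * Real.exp (13.61 * δ)) ^ 2 ≤ 395 * u ^ 2 := by
  set E := Real.exp (13.61 * δ) with hEdef
  have hE0 : 0 < E := Real.exp_pos _
  have hEm : E * (1 - 13.61 * δ) ≤ 1 := by
    have h1 : 1 - 13.61 * δ ≤ Real.exp (-(13.61 * δ)) := by
      have := Real.one_sub_le_exp_neg (13.61 * δ); simpa using this
    calc E * (1 - 13.61 * δ) ≤ E * Real.exp (-(13.61 * δ)) := mul_le_mul_of_nonneg_left h1 hE0.le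
      _ = 1 := by rw [hEdef, ← Real.exp_add]; simp
  have ha0 : 0 ≤ 13.61 * δ * E := by positivity
  have hm0 : (1 : ℝ) - 13.61 / 2 ^ 9 ≤ 1 - 13.61 * δ := by nlinarith
  have hA : 13.61 * δ * E * (1 - 13.61 / 2 ^ 9) ≤ 13.61 * u := by
    have h1 : 13.61 * δ * E * (1 - 13.61 / 2 ^ 9) ≤ 13.61 * δ * E * (1 - 13.61 * δ) :=
      mul_le_mul_of_nonneg_left hm0 ha0
    have h2 : 13.61 * δ * E * (1 - 13.61 * δ) = 13.61 * δ * (E * (1 - 13.61 * δ)) := by ring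
    have h3 : 13.61 * δ * (E * (1 - 13.61 * δ)) ≤ 13.61 * δ * 1 :=
      mul_le_mul_of_nonneg_left hEm (by positivity)
    nlinarith
  have hB : (13.61 * δ * E * (1 - 13.61 / 2 ^ 9)) ^ 2 ≤ (13.61 * u) ^ 2 := by
    have hl : 0 ≤ 13.61 * δ * E * (1 - 13.61 / 2 ^ 9) := by positivity
    exact pow_le_pow_left₀ hl hA 2
  have hC : (13.61 * δ * E) ^ 2 * (1 - 13.61 / 2 ^ 9) ^ 2 ≤ (13.61 * u) ^ 2 := by
    have : (13.61 * δ * E * (1 - 13.61 / 2 ^ 9)) ^ 2 = (13.61 * δ * E) ^ 2 * (1 - 13.61 / 2 ^ 9) ^ 2 := by ring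
    linarith [this ▸ hB]
  have hsq0 : 0 ≤ (13.61 * δ * E) ^ 2 := by positivity
  have key : 2 * (13.61 * δ * E) ^ 2 * (1 - 13.61 / 2 ^ 9) ^ 2 ≤ 2 * (13.61 * u) ^ 2 := by nlinarith
  have hm2 : (2 : ℝ) * 13.61 ^ 2 ≤ 395 * (1 - 13.61 / 2 ^ 9) ^ 2 := by norm_num
  nlinarith [key, hm2, hsq0, sq_nonneg u]

/-- One exact doubling below `2⁻⁹`: `boxDefect Z L ≤ u ≤ 2⁻⁹ ⇒ boxDefect Z (2L) ≤ 395 u²`. -/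
theorem basin_step9 (hS : IsAxisSymmetric Z) (hT : IsTracePositive Z) (hV : HasVolumeBounds Z)
    (L : ℕ) (hL : 8 ≤ L) {u : ℝ} (hu : boxDefect Z L ≤ u) (hu9 : u ≤ 1 / 2 ^ 9) :
    boxDefect Z (2 * L) ≤ 395 * u ^ 2 :=
  (defectSquaring_double_sharp hS hT hV L hL (hu.trans hu9)).trans
    (sq_step9 (boxDefect_nonneg_of_le hT L hL) hu hu9)

end Rung

/-- **PROVED RUNG**: `AbstractBasin (1/2^9) epsStar` — six exact doublings take a `2⁻⁹`-pure box (`L ≥ 8`) of ANY axis-symmetric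
trace-positive volume-bounded family to a `2⁻²⁴`-pure box of side `64L`. -/
theorem abstractBasin_two_pow_9 : AbstractBasin (1 / 2 ^ 9) epsStar := by
  intro Z hS hT hV L hL hδ
  have h1 := basin_step9 hS hT hV L hL hδ le_rfl
  have h2 := basin_step9 hS hT hV (2 * L) (by omega) h1 (by norm_num)
  have h3 := basin_step9 hS hT hV (2 * (2 * L)) (by omega) h2 (by norm_num)
  have h4 := basin_step9 hS hT hV (2 * (2 * (2 * L))) (by omega) h3 (by norm_num)
  have h5 := basin_step9 hS hT hV (2 * (2 * (2 * (2 * L)))) (by omega) h4 (by norm_num)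
  have h6 := basin_step9 hS hT hV (2 * (2 * (2 * (2 * (2 * L))))) (by omega) h5 (by norm_num)
  refine ⟨2 * (2 * (2 * (2 * (2 * (2 * L))))), by omega, h6.trans ?_⟩
  rw [epsStar_eq]; norm_num


/-- **The bill with the seed at ONE tolerance `2⁻⁹` at ONE scale**: `ColdExitAt (1/2^9) → AFToColdPressure → IRnsc → IR`. -/
theorem IR_of_exitAt9 (hE : ColdExitAt (1 / 2 ^ 9)) (hX : AFToColdPressure) (hN : IRnsc) :
    Summit.QuantumFields.YangMills.Theses.BalabanLadder.IR :=
  IR_of_exitAt (coldExitAt_of_abstractBasin hE abstractBasin_two_pow_9) hX hN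

/-- Every tolerance `θ ≤ 2⁻⁹` re-bases the bill likewise. -/
theorem IR_of_exitAt_le {θ : ℝ} (hθ : θ ≤ 1 / 2 ^ 9) (hE : ColdExitAt θ) (hX : AFToColdPressure) (hN : IRnsc) :
    Summit.QuantumFields.YangMills.Theses.BalabanLadder.IR :=
  IR_of_exitAt9 (coldExitAt_mono hθ hE) hX hN

/-- **Consistency with the bill of record**: the tree's seed `ColdExitSC` (all tolerances, all base scales) implies the new one, so
`ColdPurityBridge.IR_of_bridge`'s conclusion is recovered from strictly weaker input. -/
theorem IR_of_coldExitSC' (hE : ColdExitSC) (hX : AFToColdPressure) (hN : IRnsc) :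
    Summit.QuantumFields.YangMills.Theses.BalabanLadder.IR :=
  IR_of_exitAt9 (coldExitAt_of_coldExitSC (by norm_num) hE) hX hN

end Summit.QuantumFields.YangMills.Cruxes.IR.BasinRung

end
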